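import Literature.Computability.Cryptography.LWEGuessTestProg
import HarnessLib

/-!
# The h₃ machine's rate-guess test, II: the subroutine input as a CODE, with the subroutine's coins cut to its own tape

Topic `Computability/Cryptography` (LWE), grouping namespace `BLPRS2013.KProg`; sequel of `LWEGuessTestProg.lean` (`tQueryOf`: the `j`-th
subroutine input at the level of lists, with a fixed number `ℓ₃` of coins for the subroutine). The given decision algorithm `D₃` is run as a
RANDOMISED subroutine, i.e. on the pair `⟨u, c⟩` of the code `u = encodeLWESamples(block)` and coins `c` of length EXACTLY `coins₃(|u|)`
(`OracleAlg.randRun`, read through `OracleAlg.randAnswer` in `Complexity/OracleSubroutineRand.lean`); as in the Micciancio–Peikert machine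
(`LWEPrimePowerProgTop.topQ`) the coins are therefore cut out of the query's slice by the LENGTH OF THE CODE of its first field. This file
(everything PROVED, definitions with bodies, no named fact):

* `itemListE`/`uDataOf` (the list-level samples `(n, (q, items))` of a query and their code `LWE.MP12.Prog.ldataE`, i.e. `encodeLWESamples` on
  genuine blocks, `ldataE_toLData`), **`tQuery r coins₃ items coins j = (u_j, c_j)`** with `c_j = (slice_j.drop W_kr).take (coins₃(|ldataE u_j|))`;
* `codeFP_itemsList` (raw items ↦ headed items), **`tQuery_codeFP`** (typed polynomial time, `codeFP_polyEval` for the fixed polynomial `coins₃`), and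
  `tQuery_fst` (`(tQuery …).1 = (tQueryOf …).1`).

## References

* Z. Brakerski, A. Langlois, C. Peikert, O. Regev, D. Stehlé, *Classical hardness of learning with errors*, STOC 2013; arXiv:1306.0281,
  Lemma 2.15 with §5. [BrakerskiEtAl2013]
* S. Arora, B. Barak, *Computational Complexity: A Modern Approach*, CUP 2009, §3.4 with Def. 7.1 (a randomised subroutine reads its own
  uniform tape). [AroraBarak2009]
-/

noncomputable section

namespace Literature.Computability.Cryptography

namespace BLPRS2013

namespace KProg

open Polynomial Literature.Computability.Complexity Literature.Computability.Complexity.CodeFP LWE.MP12.Prog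

/-! ### The query with the exact coin cut -/

/-- **The `j`-th subroutine input with the subroutine's coins cut to its tape**: `(u_j, (slice_j.drop W_kr).take (coins₃ |ldataE u_j|))`.
[cite: BrakerskiEtAl2013, Lemma 2.15 with §5; AroraBarak2009, §3.4 with Def. 7.1] -/
def tQuery (r : TRec) (coins₃ : Polynomial ℕ) (items : List LItem) (coins : List Bool) (j : ℕ) : LData × List Bool :=
  let u := (tQueryOf r items coins j).1
  let slice := (coins.drop (j * r.ww)).take r.ww
  (u, (slice.drop r.wkr).take (coins₃.eval (ldataE u).length))

/-- Its first field is that of `tQueryOf`. [folklore] -/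
theorem tQuery_fst (r : TRec) (coins₃ : Polynomial ℕ) (items : List LItem) (coins : List Bool) (j : ℕ) :
    (tQuery r coins₃ items coins j).1 = (tQueryOf r items coins j).1 := rfl

/-- Taking at least the whole list is taking the whole list. [folklore] -/
theorem take_min_length (l : List Bool) (k : ℕ) : l.take (min k l.length) = l.take k := by
  rcases le_total k l.length with h | h
  · rw [min_eq_left h]
  · rw [min_eq_right h, List.take_of_length_le le_rfl, List.take_of_length_le h]

/-! ### Typed polynomial time -/

section CodeFP

/-- **Raw items to headed items**: `(rawE (pairE (rawE natE) natE)) → (listE itemE)` is the identity map, typed. [folklore] -/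
theorem codeFP_itemsList : CodeFP (rawE itemRawE) (listE itemE) (fun l => l) := by
  have hit : CodeFP itemRawE itemE (fun it => it) :=
    (((listOfRaw natE).comp (fst _ _)).pair (snd _ _)).congr fun it => by obtain ⟨a, b⟩ := it; rfl
  exact ((listOfRaw itemE).comp (map₀ hit)).congr fun l => by simp

/-- **The exact query is typed polynomial time** in `(record, items, coins, j)`. [cite: AroraBarak2009, §1.3, §3.4] -/
theorem tQuery_codeFP (coins₃ : Polynomial ℕ) : CodeFP tqArgE (pairE ldataE strE) (fun p => tQuery p.1 coins₃ p.2.1 p.2.2.1 p.2.2.2) := by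
  have hr : CodeFP tqArgE tRecE (fun p => p.1) := fst _ _
  have hcoins : CodeFP tqArgE strE (fun p => p.2.2.1) := (snd _ _).snd'.fst'
  have hj : CodeFP tqArgE natE (fun p => p.2.2.2) := (snd _ _).snd'.snd'
  have hwid : CodeFP tqArgE (pairE unE (pairE unE (pairE unE (pairE unE unE)))) (fun p => p.1.2.2.2.2.1) := hr.snd'.snd'.snd'.snd'.fst'
  have hwkr : CodeFP tqArgE unE (fun p => p.1.wkr) := hwid.snd'.snd'.fst'
  have hww : CodeFP tqArgE unE (fun p => p.1.ww) := hwid.snd'.snd'.snd'.snd'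
  -- the first field, and its code as a string
  have hq := tQueryOf_codeFP
  have hu : CodeFP tqArgE (pairE natE (pairE natE (rawE itemRawE))) (fun p => (tQueryOf p.1 p.2.1 p.2.2.1 p.2.2.2).1) := hq.fst'
  -- (convert the raw items to headed items on a VARIABLE `u`, so that no structure-eta on the big query term is needed)
  have hconv : CodeFP (pairE natE (pairE natE (rawE itemRawE))) ldataE (fun u => u) :=
    (((fst _ _).pair ((snd _ _).fst'.pair (codeFP_itemsList.comp (snd _ _).snd'))).congr fun u => by
      obtain ⟨a, b, c⟩ := u; rfl)
  have huL : CodeFP tqArgE ldataE (fun p => (tQueryOf p.1 p.2.1 p.2.2.1 p.2.2.2).1) := (hconv.comp hu :)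
  -- the code of `u` as a string (re-read the identity on `LData` with output code `strE`; on a VARIABLE, by `rfl`)
  have hcode : CodeFP ldataE strE ldataE := (CodeFP.id ldataE).recodeOut (eγ := strE) (g' := ldataE) fun _ => rfl
  have huStr : CodeFP tqArgE strE (fun p => ldataE (tQueryOf p.1 p.2.1 p.2.2.1 p.2.2.2).1) := (hcode.comp huL :)
  have hk : CodeFP tqArgE natE (fun p => coins₃.eval (ldataE (tQueryOf p.1 p.2.1 p.2.2.1 p.2.2.2).1).length) :=
    ((codeFP_polyEval coins₃).comp (strNatLength.comp huStr) :)
  -- the slice and the cut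
  have hjoff : CodeFP tqArgE unE (fun p => min (p.2.2.2 * p.1.ww) p.2.2.1.length) :=
    (unOfNatMin.comp ((strLength.comp hcoins).pair (natMul.comp (hj.pair (natOfUn.comp hww)))) :)
  have hslice : CodeFP tqArgE strE (fun p => (p.2.2.1.drop (p.2.2.2 * p.1.ww)).take p.1.ww) :=
    (strTake.comp (hww.pair (strDrop.comp (hjoff.pair hcoins)))).congr fun p => by
      show List.take _ (List.drop (min _ _) _) = _; rw [drop_min_length]
  have htail : CodeFP tqArgE strE (fun p => ((p.2.2.1.drop (p.2.2.2 * p.1.ww)).take p.1.ww).drop p.1.wkr) := (strDrop.comp (hwkr.pair hslice) :)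
  have hcut : CodeFP tqArgE strE (fun p => (((p.2.2.1.drop (p.2.2.2 * p.1.ww)).take p.1.ww).drop p.1.wkr).take
      (min (coins₃.eval (ldataE (tQueryOf p.1 p.2.1 p.2.2.1 p.2.2.2).1).length) (((p.2.2.1.drop (p.2.2.2 * p.1.ww)).take p.1.ww).drop p.1.wkr).length)) :=
    (strTake.comp ((unOfNatMin.comp ((strLength.comp htail).pair hk)).pair htail) :)
  have hcut' : CodeFP tqArgE strE (fun p => (((p.2.2.1.drop (p.2.2.2 * p.1.ww)).take p.1.ww).drop p.1.wkr).take
      (coins₃.eval (ldataE (tQueryOf p.1 p.2.1 p.2.2.1 p.2.2.2).1).length)) :=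
    hcut.congr fun p => take_min_length _ _
  exact ((huL.pair hcut').congr fun p => rfl)

end CodeFP

end KProg

end BLPRS2013

end Literature.Computability.Cryptography

end
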